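import Summits.NavierStokesRegularity.NavierStokesRegularity.Theorems.FrequencyRigidity.Negative.FrequencyStructure
import Summits.NavierStokesRegularity.NavierStokesRegularity.Theorems.AdaptedFrequencyFrequencyRigidityUnitTimeDerivBounds
import Summits.NavierStokesRegularity.NavierStokesRegularity.Theorems.AdaptedFrequencyFrequencyRigidityScaleInvariantBoundsOfUnitTime
import Summits.NavierStokesRegularity.NavierStokesRegularity.Theorems.AdaptedFrequencyFrequencyRigidityVorticitySqTransport
import Summits.NavierStokesRegularity.NavierStokesRegularity.Theorems.AdaptedFrequencyFrequencyRigidityKernelPairing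
import Summits.NavierStokesRegularity.NavierStokesRegularity.Theorems.AdaptedFrequencyFrequencyRigidityVorticitySqBounds
import Literature.Analysis.FluidPDE.AdaptedBackwardKernel
import Literature.Analysis.FluidPDE.SelfSimilar
import Literature.Analysis.FluidPDE.TaoEnstrophyLocalisation
import HarnessLib

/-!
# Crux `FrequencyRigidity` (stmt-NavierStokesRegularity-2955), line `two-ended-pinning`:
# the FLAT REDUCTION — the crux is EQUIVALENT to its pinned normal form (Stub 3)

Helper file (`--supports stmt-NavierStokesRegularity-2955`; theorems only, sorry-free).  With the five
landed stubs of the picked line (wave 1: `stub_unitTimeDerivBounds`,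
`stub_scaleInvariantBounds_of_unitTime`, `stub_vorticitySqTransport`, `stub_kernelPairing`,
`stub_vorticitySqBounds`) and the disprover's landed pinning theorems (T)
(`Negative.FreqClause.exponent_eq_two`, `Negative.FreqClause.power_law`), the crux
`FrequencyRigidity` is logically EQUIVALENT to the registered Stub 3 `stub_flatEnstrophyLiouville`
("no flat inhabitant": no classical ancient Navier–Stokes flow with the global time-Type-I bound,
the scale-invariant derivative bounds, an adapted two-sided Gaussian-comparable kernel at `(0,0)`,
and the EXACT enstrophy law `H(t) = A(−t)^{−2}`, `A > 0`, with the transport-free first variation):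

* `frequencyRigidity_of_flatEnstrophyLiouville` (⇐, the line's composition made unconditional in
  its analytic inputs): a witness has scale-invariant bounds (`scaleInvariantBounds`), its adapted
  enstrophy is `C¹` with the transport-free first variation (`enstrophyFirstVariation`) and obeys the
  two-ended bound `H ≤ (‖curlCLM‖C'₁)²(−t)^{−2}` (`adaptedEnstrophy_le_of_bounds`), so (T) pins
  `Λ₀ = 2` and makes `H = H(−1)(−t)^{−2}` flat with `A = H(−1) > 0`;
* `flatEnstrophyLiouville_of_frequencyRigidity` (⇒): a flat inhabitant IS a witness with `Λ₀ = 2`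
  (`deriv` of `A(−t)^{−2}` on the open set `(−∞,0)` is `2A(−t)^{−3}`, so `Λ ≡ 2`);
* `stub_flatReduction` (registered sub-goal): the `↔`.

So the residual content of the crux is exactly Stub 3, which contains bounded-profile backward
rotated-self-similar Liouville for every rotation speed `α` (the disprover's `Negative/RSSWall`,
Pineau–Vicol 2026 Conj. 1.1 = Bradshaw–Tsai 2017 OP 5.2 on the window `α ≈ 1`); its `α = 0` leaf is
closed in `AdaptedFrequencyFrequencyRigidityFlatSelfSimilarLeaf` (Tsai 1998 Thm 1, `q = ∞`).

## References

* G. Koch, N. Nadirashvili, G. Seregin, V. Šverák, Acta Math. 203 (2009), §4. [KochNadirashviliSereginSverak2009]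
* C.-C. Poon, Comm. PDE 21 (1996), §2. [Poon1996]
* T.-P. Tsai, Arch. Rational Mech. Anal. 143 (1998), Thm 1. [Tsai1998]
-/

noncomputable section

namespace Summit.NavierStokesRegularity.NavierStokesRegularity.Theorems.FrequencyRigidity.TwoEndedPinning

open Literature.Analysis.FluidPDE MeasureTheory Set Filter Topology Function
open scoped RealInnerProductSpace Laplacian ContDiff

/-! ## The two analytic inputs of the pinning, from the landed stubs -/

/-- **Scale-invariant derivative bounds** (planner's Stub 1): every classical ancient flow with the
global time-Type-I bound obeys `‖Dᵏv(t,x)‖ ≤ C'_k (−t)^{−(k+1)/2}`, `k ≥ 1`, with constants depending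
on `(ν, C, k)` only — Stubs 1a + 1b. [cite: KochNadirashviliSereginSverak2009, §4 (4.10)] -/
theorem scaleInvariantBounds (ν C : ℝ) (hν : 0 < ν) : ∃ C' : ℕ → ℝ,
    ∀ (v : ℝ → EuclideanSpace ℝ (Fin 3) → EuclideanSpace ℝ (Fin 3))
      (q : ℝ → EuclideanSpace ℝ (Fin 3) → ℝ),
      IsClassicalNSSolutionOn (Iio 0) ν 0 v q → HasTypeITimeDecay C v →
      ∀ k : ℕ, 1 ≤ k → ∀ t : ℝ, t < 0 → ∀ x : EuclideanSpace ℝ (Fin 3),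
        ‖iteratedFDeriv ℝ k (v t) x‖ ≤ C' k * (-t) ^ (-((k : ℝ) + 1) / 2) :=
  stub_scaleInvariantBounds_of_unitTime stub_unitTimeDerivBounds ν C hν

/-- **Transport-free first variation of the adapted enstrophy** (planner's Stub 2): under the
classical hypotheses, the Type-I and scale-invariant bounds and an adapted Gaussian-comparable kernel,
`H(t) = ∫ ‖curl v(t)‖² K(t)` has derivative `2∫(⟪ω, Dv ω⟫ − ν|Dω|²_F)K` at every `t < 0` — Stubs 2b
(kernel pairing) at `φ = ‖curl v‖²`, 2c (its hypotheses) and 2a (pointwise transport identity). [cite: Poon1996, §2] -/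
theorem enstrophyFirstVariation (ν C : ℝ) (C' : ℕ → ℝ)
    (v : ℝ → EuclideanSpace ℝ (Fin 3) → EuclideanSpace ℝ (Fin 3)) (q : ℝ → EuclideanSpace ℝ (Fin 3) → ℝ)
    (K : ℝ → EuclideanSpace ℝ (Fin 3) → ℝ) (hNS : IsClassicalNSSolutionOn (Iio 0) ν 0 v q)
    (hTI : HasTypeITimeDecay C v)
    (hB : ∀ k : ℕ, 1 ≤ k → ∀ t : ℝ, t < 0 → ∀ x : EuclideanSpace ℝ (Fin 3),
      ‖iteratedFDeriv ℝ k (v t) x‖ ≤ C' k * (-t) ^ (-((k : ℝ) + 1) / 2))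
    (hK : IsAdaptedBackwardKernel ν v (Iio 0) 0 0 K) (hG : IsGaussianComparable K (Iio 0) 0 0)
    {t : ℝ} (ht : t < 0) :
    HasDerivAt (adaptedEnstrophy v K)
      (∫ x, (2 * (⟪curl (v t) x, fderiv ℝ (v t) x (curl (v t) x)⟫
        - ν * frobeniusNormSq (fderiv ℝ (curl (v t)) x))) * K t x) t := by
  obtain ⟨hφ, hbd⟩ := stub_vorticitySqBounds ν C C' v q hNS hTI hB
  have hd := stub_kernelPairing ν C v K (fun t x => ‖curl (v t) x‖ ^ 2) hNS.smooth_velocity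
    hNS.divFree hTI hK hG hφ hbd t ht
  have hfun : adaptedEnstrophy v K = fun s => ∫ x, ‖curl (v s) x‖ ^ 2 * K s x := rfl
  have hint : (∫ x, (deriv (fun s => ‖curl (v s) x‖ ^ 2) t
        + fderiv ℝ (fun y => ‖curl (v t) y‖ ^ 2) x (v t x)
        - ν * Laplacian.laplacian (fun y => ‖curl (v t) y‖ ^ 2) x) * K t x) =
      ∫ x, (2 * (⟪curl (v t) x, fderiv ℝ (v t) x (curl (v t) x)⟫
        - ν * frobeniusNormSq (fderiv ℝ (curl (v t)) x))) * K t x := by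
    refine integral_congr_ae (Eventually.of_forall fun x => ?_)
    show (deriv (fun s => ‖curl (v s) x‖ ^ 2) t
        + fderiv ℝ (fun y => ‖curl (v t) y‖ ^ 2) x (v t x)
        - ν * Laplacian.laplacian (fun y => ‖curl (v t) y‖ ^ 2) x) * K t x = _
    rw [stub_vorticitySqTransport ν v q hNS t ht x]
  rw [hfun, ← hint]
  exact hd

/-! ## The two-ended enstrophy bound -/

/-- `‖curl v(t,x)‖ ≤ ‖curlCLM‖ · C'_1 · (−t)^{−1}` under the scale-invariant bounds (`k = 1`). [folklore] -/
theorem norm_curl_le_of_bounds {C' : ℕ → ℝ} {v : ℝ → EuclideanSpace ℝ (Fin 3) → EuclideanSpace ℝ (Fin 3)}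
    (hB : ∀ k : ℕ, 1 ≤ k → ∀ t : ℝ, t < 0 → ∀ x : EuclideanSpace ℝ (Fin 3),
      ‖iteratedFDeriv ℝ k (v t) x‖ ≤ C' k * (-t) ^ (-((k : ℝ) + 1) / 2))
    {t : ℝ} (ht : t < 0) (x : EuclideanSpace ℝ (Fin 3)) :
    ‖curl (v t) x‖ ≤ ‖curlCLM‖ * C' 1 * (-t) ^ (-(1 : ℝ)) := by
  have h1 := hB 1 le_rfl t ht x
  rw [norm_iteratedFDeriv_one] at h1
  have h2 : (-(((1 : ℕ) : ℝ) + 1) / 2 : ℝ) = -(1 : ℝ) := by norm_num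
  rw [h2] at h1
  calc ‖curl (v t) x‖ ≤ ‖curlCLM‖ * ‖fderiv ℝ (v t) x‖ := norm_curl_le _ _
    _ ≤ ‖curlCLM‖ * (C' 1 * (-t) ^ (-(1 : ℝ))) :=
        mul_le_mul_of_nonneg_left h1 (norm_nonneg curlCLM)
    _ = ‖curlCLM‖ * C' 1 * (-t) ^ (-(1 : ℝ)) := by ring

/-- **The two-ended Type-I enstrophy bound** `H(t) ≤ (‖curlCLM‖ C'_1)² (−t)^{−2}` for every `t < 0`
(pointwise vorticity bound, positivity and unit mass of the kernel). [folklore] -/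
theorem adaptedEnstrophy_le_of_bounds {ν : ℝ} {C' : ℕ → ℝ}
    {v : ℝ → EuclideanSpace ℝ (Fin 3) → EuclideanSpace ℝ (Fin 3)} {K : ℝ → EuclideanSpace ℝ (Fin 3) → ℝ}
    (hB : ∀ k : ℕ, 1 ≤ k → ∀ t : ℝ, t < 0 → ∀ x : EuclideanSpace ℝ (Fin 3),
      ‖iteratedFDeriv ℝ k (v t) x‖ ≤ C' k * (-t) ^ (-((k : ℝ) + 1) / 2))
    (hK : IsAdaptedBackwardKernel ν v (Iio 0) 0 0 K) {t : ℝ} (ht : t < 0) :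
    (∫ x, ‖curl (v t) x‖ ^ 2 * K t x) ≤ (‖curlCLM‖ * C' 1) ^ 2 * (-t) ^ (-(2 : ℝ)) := by
  have hneg : 0 < -t := by linarith
  have ht' : t ∈ Iio (0 : ℝ) := ht
  have hsq : ∀ x, ‖curl (v t) x‖ ^ 2 ≤ (‖curlCLM‖ * C' 1) ^ 2 * (-t) ^ (-(2 : ℝ)) := fun x => by
    have hω := norm_curl_le_of_bounds hB ht x
    have h1 : ‖curl (v t) x‖ ^ 2 ≤ (‖curlCLM‖ * C' 1 * (-t) ^ (-(1 : ℝ))) ^ 2 :=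
      pow_le_pow_left₀ (norm_nonneg _) hω 2
    have h2 : ((-t) ^ (-(1 : ℝ))) ^ 2 = (-t) ^ (-(2 : ℝ)) := by
      rw [← Real.rpow_natCast, ← Real.rpow_mul hneg.le]
      norm_num
    calc ‖curl (v t) x‖ ^ 2 ≤ (‖curlCLM‖ * C' 1 * (-t) ^ (-(1 : ℝ))) ^ 2 := h1
      _ = (‖curlCLM‖ * C' 1) ^ 2 * ((-t) ^ (-(1 : ℝ))) ^ 2 := by ring
      _ = (‖curlCLM‖ * C' 1) ^ 2 * (-t) ^ (-(2 : ℝ)) := by rw [h2]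
  have hint : Integrable (fun x => (‖curlCLM‖ * C' 1) ^ 2 * (-t) ^ (-(2 : ℝ)) * K t x) :=
    (hK.integrable ht').const_mul _
  calc (∫ x, ‖curl (v t) x‖ ^ 2 * K t x)
      ≤ ∫ x, (‖curlCLM‖ * C' 1) ^ 2 * (-t) ^ (-(2 : ℝ)) * K t x :=
        integral_mono_of_nonneg
          (Eventually.of_forall fun x => mul_nonneg (sq_nonneg _) (hK.pos t ht' x).le) hint
          (Eventually.of_forall fun x => mul_le_mul_of_nonneg_right (hsq x) (hK.pos t ht' x).le)
    _ = (‖curlCLM‖ * C' 1) ^ 2 * (-t) ^ (-(2 : ℝ)) := by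
        rw [integral_const_mul, hK.integral_eq_one t ht', mul_one]

/-! ## The flat reduction -/

/-- **`FrequencyRigidity` from Stub 3** (the line's composition with its analytic inputs now
PROVED): unbundle a witness (`Negative.frequencyRigidity_iff`); `scaleInvariantBounds` and
`enstrophyFirstVariation` supply the inputs `hM`, `hd` of the disprover's checked pinning
`FreqClause.exponent_eq_two` (`Λ₀ = 2`) and `FreqClause.power_law` (`H = H(−1)(−t)^{−2}`), which
turn the witness into a flat inhabitant with `A = H(−1) > 0`; Stub 3 forbids it. [folklore] -/
theorem frequencyRigidity_of_flatEnstrophyLiouville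
    (h₃ : ∀ (ν C A : ℝ) (C' : ℕ → ℝ) (v : ℝ → EuclideanSpace ℝ (Fin 3) → EuclideanSpace ℝ (Fin 3))
      (q : ℝ → EuclideanSpace ℝ (Fin 3) → ℝ) (K : ℝ → EuclideanSpace ℝ (Fin 3) → ℝ),
      ¬ (0 < ν ∧ Literature.Analysis.FluidPDE.IsClassicalNSSolutionOn (Set.Iio 0) ν 0 v q ∧
          Literature.Analysis.FluidPDE.HasTypeITimeDecay C v ∧
          (∀ k : ℕ, 1 ≤ k → ∀ t : ℝ, t < 0 → ∀ x : EuclideanSpace ℝ (Fin 3),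
            ‖iteratedFDeriv ℝ k (v t) x‖ ≤ C' k * (-t) ^ (-((k : ℝ) + 1) / 2)) ∧
          Literature.Analysis.FluidPDE.IsAdaptedBackwardKernel ν v (Set.Iio 0) 0 0 K ∧
          Literature.Analysis.FluidPDE.IsGaussianComparable K (Set.Iio 0) 0 0 ∧ 0 < A ∧
          (∀ t : ℝ, t < 0 →
            Literature.Analysis.FluidPDE.adaptedEnstrophy v K t = A * (-t) ^ (-(2 : ℝ))) ∧
          (∀ t : ℝ, t < 0 →
            HasDerivAt (Literature.Analysis.FluidPDE.adaptedEnstrophy v K)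
              (∫ x, (2 * (inner ℝ (Literature.Analysis.FluidPDE.curl (v t) x)
                            (fderiv ℝ (v t) x (Literature.Analysis.FluidPDE.curl (v t) x))
                          - ν * Literature.Analysis.FluidPDE.frobeniusNormSq
                            (fderiv ℝ (Literature.Analysis.FluidPDE.curl (v t)) x))) * K t x) t))) :
    Theses.AdaptedFrequency.FrequencyRigidity := by
  rw [Negative.frequencyRigidity_iff]
  rintro ⟨ν, C, Λ₀, v, q, K, hν, hNS, hTI, hKc, hCmp, hF⟩
  have hTI' : HasTypeITimeDecay C v := fun t ht x => hTI t ht x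
  obtain ⟨hK1, hK2, hK3, hK4, hK5⟩ := hKc
  have hK : IsAdaptedBackwardKernel ν v (Iio 0) 0 0 K := ⟨hK1, hK2, hK3, hK4, hK5⟩
  obtain ⟨c₁, c₂, C₁, C₂, hc₁, hc₂, hC₁, hC₂, hcmp⟩ := hCmp
  have hG : IsGaussianComparable K (Iio 0) 0 0 :=
    isGaussianComparable_iff_fin_three.2 ⟨c₁, c₂, C₁, C₂, hc₁, hc₂, hC₁, hC₂, hcmp⟩
  obtain ⟨C', hC'⟩ := scaleInvariantBounds ν C hν
  have hB := hC' v q hNS hTI'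
  have hFV : ∀ t : ℝ, t < 0 → HasDerivAt (adaptedEnstrophy v K)
      (∫ x, (2 * (⟪curl (v t) x, fderiv ℝ (v t) x (curl (v t) x)⟫
        - ν * frobeniusNormSq (fderiv ℝ (curl (v t)) x))) * K t x) t :=
    fun t ht => enstrophyFirstVariation ν C C' v q K hNS hTI' hB hK hG ht
  have hd : ∀ t < 0, DifferentiableAt ℝ (fun t => ∫ x, ‖curl (v t) x‖ ^ 2 * K t x) t :=
    fun t ht => (hFV t ht).differentiableAt
  have hM : ∀ t < 0, (∫ x, ‖curl (v t) x‖ ^ 2 * K t x) ≤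
      (‖curlCLM‖ * C' 1) ^ 2 * (-t) ^ (-(2 : ℝ)) :=
    fun t ht => adaptedEnstrophy_le_of_bounds hB hK ht
  have hΛ : Λ₀ = 2 := hF.exponent_eq_two hd hM
  refine h₃ ν C (∫ x, ‖curl (v (-1)) x‖ ^ 2 * K (-1) x) C' v q K
    ⟨hν, hNS, hTI', hB, hK, hG, ?_, ?_, hFV⟩
  · exact (hF _ _ rfl rfl).1 (-1) (by norm_num)
  · intro t ht
    rw [adaptedEnstrophy_apply, hF.power_law hd ht, hΛ]

/-- **Stub 3 from `FrequencyRigidity`**: a flat inhabitant is a witness against the crux with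
`Λ₀ = 2` — its adapted enstrophy `H(t) = A(−t)^{−2}` is positive and, `(−∞,0)` being open,
`deriv H t = 2A(−t)^{−3}`, so `Λ(t) = (0 − t) · 2A(−t)^{−3} / (A(−t)^{−2}) = 2`. [folklore] -/
theorem flatEnstrophyLiouville_of_frequencyRigidity (h : Theses.AdaptedFrequency.FrequencyRigidity) :
    ∀ (ν C A : ℝ) (C' : ℕ → ℝ) (v : ℝ → EuclideanSpace ℝ (Fin 3) → EuclideanSpace ℝ (Fin 3))
      (q : ℝ → EuclideanSpace ℝ (Fin 3) → ℝ) (K : ℝ → EuclideanSpace ℝ (Fin 3) → ℝ),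
      ¬ (0 < ν ∧ Literature.Analysis.FluidPDE.IsClassicalNSSolutionOn (Set.Iio 0) ν 0 v q ∧
          Literature.Analysis.FluidPDE.HasTypeITimeDecay C v ∧
          (∀ k : ℕ, 1 ≤ k → ∀ t : ℝ, t < 0 → ∀ x : EuclideanSpace ℝ (Fin 3),
            ‖iteratedFDeriv ℝ k (v t) x‖ ≤ C' k * (-t) ^ (-((k : ℝ) + 1) / 2)) ∧
          Literature.Analysis.FluidPDE.IsAdaptedBackwardKernel ν v (Set.Iio 0) 0 0 K ∧
          Literature.Analysis.FluidPDE.IsGaussianComparable K (Set.Iio 0) 0 0 ∧ 0 < A ∧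
          (∀ t : ℝ, t < 0 →
            Literature.Analysis.FluidPDE.adaptedEnstrophy v K t = A * (-t) ^ (-(2 : ℝ))) ∧
          (∀ t : ℝ, t < 0 →
            HasDerivAt (Literature.Analysis.FluidPDE.adaptedEnstrophy v K)
              (∫ x, (2 * (inner ℝ (Literature.Analysis.FluidPDE.curl (v t) x)
                            (fderiv ℝ (v t) x (Literature.Analysis.FluidPDE.curl (v t) x))
                          - ν * Literature.Analysis.FluidPDE.frobeniusNormSq
                            (fderiv ℝ (Literature.Analysis.FluidPDE.curl (v t)) x))) * K t x) t)) := by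
  rintro ν C A C' v q K ⟨hν, hNS, hTI, -, hK, hG, hA, hflat, -⟩
  rw [Negative.frequencyRigidity_iff] at h
  refine h ⟨ν, C, 2, v, q, K, hν, hNS, fun t ht x => hTI t ht x,
    ⟨hK.contDiffOn, hK.pos, hK.adjoint_eq, hK.integral_eq_one, hK.tendsto_integral_mul⟩,
    isGaussianComparable_iff_fin_three.1 hG, ?_⟩
  intro H Λ hH hΛ
  have hHt : ∀ t ∈ Iio (0 : ℝ), H t = A * (-t) ^ (-(2 : ℝ)) := fun t ht => by
    rw [hH]; exact (adaptedEnstrophy_apply v K t).symm.trans (hflat t ht)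
  refine ⟨fun t ht => ?_, fun t ht => ?_⟩
  · rw [hHt t ht]
    exact mul_pos hA (Real.rpow_pos_of_pos (neg_pos.2 ht) _)
  · have ht0 : 0 < -t := neg_pos.2 ht
    have hev : H =ᶠ[𝓝 t] fun s => A * (-s) ^ (-(2 : ℝ)) :=
      Filter.eventuallyEq_of_mem (Iio_mem_nhds ht) fun s hs => hHt s hs
    have hder : HasDerivAt (fun s : ℝ => A * (-s) ^ (-(2 : ℝ)))
        (A * ((-1) * (-(2 : ℝ)) * (-t) ^ (-(2 : ℝ) - 1))) t :=
      ((hasDerivAt_neg t).rpow_const (Or.inl ht0.ne')).const_mul A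
    rw [hΛ]
    dsimp only
    rw [hev.deriv_eq, hder.deriv, hHt t ht]
    have h3 : (-t) ^ (-(2 : ℝ) - 1) = (-t) ^ (-(2 : ℝ)) * (-t)⁻¹ := by
      rw [show (-(2 : ℝ) - 1) = -(2 : ℝ) + (-1) by norm_num, Real.rpow_add ht0,
        Real.rpow_neg_one]
    rw [h3]
    have hp : (-t) ^ (-(2 : ℝ)) ≠ 0 := (Real.rpow_pos_of_pos ht0 _).ne'
    have hA0 : A ≠ 0 := hA.ne'
    have ht0' : -t ≠ 0 := ht0.ne'
    have htne : t ≠ 0 := (show t < 0 from ht).ne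
    field_simp
    ring

/-- **Registered sub-goal `stub_flatReduction`: the crux `FrequencyRigidity` is EQUIVALENT to
Stub 3 of line `two-ended-pinning`** (no flat inhabitant), unconditionally in Lean given the five
landed analytic stubs and the landed pinning (T).  Consequently the open content of the crux is
exactly Stub 3 (⊇ bounded-profile backward RSS-Liouville for every `α`). [folklore] -/
theorem stub_flatReduction :
    Summit.NavierStokesRegularity.NavierStokesRegularity.Theses.AdaptedFrequency.FrequencyRigidity ↔
    ∀ (ν C A : ℝ) (C' : ℕ → ℝ) (v : ℝ → EuclideanSpace ℝ (Fin 3) → EuclideanSpace ℝ (Fin 3))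
      (q : ℝ → EuclideanSpace ℝ (Fin 3) → ℝ) (K : ℝ → EuclideanSpace ℝ (Fin 3) → ℝ),
      ¬ (0 < ν ∧ Literature.Analysis.FluidPDE.IsClassicalNSSolutionOn (Set.Iio 0) ν 0 v q ∧
          Literature.Analysis.FluidPDE.HasTypeITimeDecay C v ∧
          (∀ k : ℕ, 1 ≤ k → ∀ t : ℝ, t < 0 → ∀ x : EuclideanSpace ℝ (Fin 3),
            ‖iteratedFDeriv ℝ k (v t) x‖ ≤ C' k * (-t) ^ (-((k : ℝ) + 1) / 2)) ∧
          Literature.Analysis.FluidPDE.IsAdaptedBackwardKernel ν v (Set.Iio 0) 0 0 K ∧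
          Literature.Analysis.FluidPDE.IsGaussianComparable K (Set.Iio 0) 0 0 ∧ 0 < A ∧
          (∀ t : ℝ, t < 0 →
            Literature.Analysis.FluidPDE.adaptedEnstrophy v K t = A * (-t) ^ (-(2 : ℝ))) ∧
          (∀ t : ℝ, t < 0 →
            HasDerivAt (Literature.Analysis.FluidPDE.adaptedEnstrophy v K)
              (∫ x, (2 * (inner ℝ (Literature.Analysis.FluidPDE.curl (v t) x)
                            (fderiv ℝ (v t) x (Literature.Analysis.FluidPDE.curl (v t) x))
                          - ν * Literature.Analysis.FluidPDE.frobeniusNormSq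
                            (fderiv ℝ (Literature.Analysis.FluidPDE.curl (v t)) x))) * K t x) t)) :=
  ⟨flatEnstrophyLiouville_of_frequencyRigidity, frequencyRigidity_of_flatEnstrophyLiouville⟩

end Summit.NavierStokesRegularity.NavierStokesRegularity.Theorems.FrequencyRigidity.TwoEndedPinning

end
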